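import Summits.QuantumFields.BalabanUV.T4Continuum.Support.DirichletMonotoneCutoff

/-!
# `BalabanUV.T4Continuum.Support.ScaleProfile` — NE2 (node U1a) formalisation swarm, sub-row `T4-U1a.S-NE2-D1-DIRICHLET°`, supplier item
# «Δ1-SKELETON» (file 2): LATTICE CUTOFF PROFILES AT AN ARBITRARY SCALE `R` (clamped cubic-smoothstep ramp, plateau-and-ramp profile)
# WITH UNIFORM FIRST ∕ SECOND DIFFERENCE BOUNDS `3/(2(R−1))` ∕ `6/(R−1)²`, and the FIRST ∕ SECOND DIFFERENCE BOUNDS OF A FINITE PRODUCT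
# OF `[0,1]`-VALUED FACTORS (unit b2b-balaban-t4-ne2-formalise-leaf-08, gen 7, file 2)

HONEST FRAMING.  Rung (B)+1 bookkeeping at MODEL level; pure real polynomial inequalities ∕ finite algebra; NE2 (U1a) is NOT proved by this
file; spine PROVED 0/9 unchanged; NOT infinite volume, NOT the mass gap, NOT Clay.  HONEST DEPENDENCY (verbatim): «continuum YM on T⁴ ⇐
BetaPertH ∧ nine spine estimates (0/9 proved); BetaPertH ⇐ (D1) ∧ (D4) ∧ CAP+tail; G-an2-4 gates asym, D1 and NE2/3/4.»

WHAT THIS FILE PROVES (0 sorry; gen 3's `DirichletMonotoneCutoff.{sstep, rampUp}` and its difference lemmas BY NAME).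
 * §1 **`pclamp R i`** = the clamped rising ramp `rampUp R i` for `i + 1 ≤ R`, `1` beyond (`R ≥ 2`): values in `[0,1]`, `pclamp R 0 = 0`,
   `pclamp R i = 1` for `R ≤ i + 1`, **`pclamp_step`** `|p(i+1) − p(i)| ≤ 3/(2(R−1))` and **`pclamp_second`** `|p(i+2) − 2p(i+1) + p(i)| ≤ 6/(R−1)²`
   for EVERY `i` (the top junction is second-order flat: `one_sub_rampUp_le`), and the flat start `pclamp R 1 ≤ 3/(R−1)²`;
 * §2 **`qprof R R₁ i = 1 − pclamp R (i − R₁)`** = plateau `1` on `[0, R₁]`, decreasing to `0` for `R₁ + R ≤ i + 1`: values in `[0,1]`,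
   **`qprof_step`**, **`qprof_second`** with the same constants for EVERY `i` (the plateau junction is second-order flat: `rampUp_one_le`),
   `qprof_eq_one`, `qprof_eq_zero`; these are the one-dimensional factors of every cutoff of the item (dips, transversal windows, the
   indicator of the cut-out set), at the scale `R` of the cut-out;
 * §3 **`abs_prod_sub_prod_le`**: for `[0,1]`-valued `f, g` on a finset, `|∏ f − ∏ g| ≤ Σ |f − g|`; **`abs_prod_second_le`**:
   `|∏ f + ∏ h − 2∏ g| ≤ Σ |f + h − 2g| + (Σ|f − g|)² + (Σ|h − g|)²` — the product rule that turns factorwise smoothness into smoothness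
   of a product cutoff `Π (1 − dip)`, with only the NON-CONSTANT factors contributing.

ABSOLUTE RULE (cell, verbatim): «No internally-minted statement may enter as a cited fact. Every hypothesis is either kernel-proved in
this package or a verbatim quotation of a PUBLISHED theorem with page reference. The manuscript(s) under audit are NOT citable for
their own disputed steps — they are the thing under adjudication; programme-internal (2001/route/tribunal) claims are never citable.»
[folklore]; data definitions only; no `def … : Prop` fact.  NOT CLAIMED: anything about regions; NE2; NE3.
-/

noncomputable section

open scoped BigOperators
open Finset

namespace Summit.QuantumFields.BalabanUV.T4Continuum.ScaleProfile

open Summit.QuantumFields.BalabanUV.T4Continuum.DirichletMonotoneCutoff (sstep rampUp rampUp_mem rampUp_zero rampUp_last rampUp_step_le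
  rampUp_second_le rampUp_one_le one_sub_rampUp_le pred_pos)

/-! ## §1 The clamped rising ramp at scale `R` -/

/-- the clamped rising ramp at scale `R`: `rampUp R i = s(i/(R−1))` while `i + 1 ≤ R`, then `1`. [folklore] -/
def pclamp (R i : ℕ) : ℝ := if i + 1 ≤ R then rampUp R i else 1

/-- the Lipschitz constant `3/(2(R−1))` of the profiles. [folklore] -/
def lip1 (R : ℕ) : ℝ := 3 / 2 * (1 / ((R : ℝ) - 1))

/-- the second-difference constant `6/(R−1)²` of the profiles. [folklore] -/
def lip2 (R : ℕ) : ℝ := 6 * (1 / ((R : ℝ) - 1)) ^ 2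

section Clamp

variable {R : ℕ} (hR : 2 ≤ R)
include hR

/-- `lip1 R ≥ 0`. [folklore] -/
theorem lip1_nonneg : 0 ≤ lip1 R := by have := pred_pos hR; unfold lip1; positivity

omit hR in
/-- `lip2 R ≥ 0`. [folklore] -/
theorem lip2_nonneg : 0 ≤ lip2 R := by unfold lip2; positivity

omit hR in
/-- `pclamp R 0 = 0` (`R ≥ 1`). [folklore] -/
theorem pclamp_zero (h1 : 1 ≤ R) : pclamp R 0 = 0 := by simp [pclamp, h1, rampUp_zero]

/-- `pclamp R i = 1` past the ramp (`R ≤ i + 1`). [folklore] -/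
theorem pclamp_of_le {i : ℕ} (h : R ≤ i + 1) : pclamp R i = 1 := by
  unfold pclamp
  split_ifs with h'
  · have hi : i = R - 1 := by omega
    subst hi; exact rampUp_last hR
  · rfl

omit hR in
/-- `pclamp R i = rampUp R i` on the ramp. [folklore] -/
theorem pclamp_of_lt {i : ℕ} (h : i + 1 ≤ R) : pclamp R i = rampUp R i := by simp [pclamp, h]

/-- `0 ≤ pclamp ≤ 1`. [folklore] -/
theorem pclamp_mem (i : ℕ) : 0 ≤ pclamp R i ∧ pclamp R i ≤ 1 := by
  unfold pclamp
  split_ifs with h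
  · exact rampUp_mem hR h
  · exact ⟨zero_le_one, le_rfl⟩

/-- **first differences**: `|pclamp R (i+1) − pclamp R i| ≤ 3/(2(R−1))` for every `i`. [folklore] -/
theorem pclamp_step (i : ℕ) : |pclamp R (i + 1) - pclamp R i| ≤ lip1 R := by
  by_cases h : i + 2 ≤ R
  · rw [pclamp_of_lt (by omega), pclamp_of_lt (by omega)]; exact rampUp_step_le hR h
  · rw [pclamp_of_le hR (by omega), pclamp_of_le hR (by omega), sub_self, abs_zero]; exact lip1_nonneg hR

/-- **second differences**: `|pclamp R (i+2) − 2·pclamp R (i+1) + pclamp R i| ≤ 6/(R−1)²` for every `i` (interior: the smoothstep;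
the top junction: `|1 − rampUp R (R−2)| ≤ 3/(R−1)²`; beyond: constant). [folklore] -/
theorem pclamp_second (i : ℕ) : |pclamp R (i + 2) - 2 * pclamp R (i + 1) + pclamp R i| ≤ lip2 R := by
  by_cases h3 : i + 3 ≤ R
  · rw [pclamp_of_lt (by omega), pclamp_of_lt (by omega), pclamp_of_lt (by omega)]
    have := rampUp_second_le hR (t := i + 1) (by omega) (by omega)
    rw [show i + 1 + 1 = i + 2 by ring, Nat.add_sub_cancel] at this
    calc |rampUp R (i + 2) - 2 * rampUp R (i + 1) + rampUp R i|
        = |2 * rampUp R (i + 1) - rampUp R (i + 2) - rampUp R i| := by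
          rw [show rampUp R (i + 2) - 2 * rampUp R (i + 1) + rampUp R i = -(2 * rampUp R (i + 1) - rampUp R (i + 2) - rampUp R i) by ring,
            abs_neg]
      _ ≤ lip2 R := this
  · by_cases h2 : i + 2 = R
    · -- the top junction: values `rampUp R (R−2)`, `1`, `1`
      rw [pclamp_of_le hR (by omega), pclamp_of_le hR (by omega), pclamp_of_lt (by omega)]
      have e : i = R - 2 := by omega
      subst e
      calc |(1 : ℝ) - 2 * 1 + rampUp R (R - 2)| = |1 - rampUp R (R - 2)| := by
            rw [show (1 : ℝ) - 2 * 1 + rampUp R (R - 2) = -(1 - rampUp R (R - 2)) by ring, abs_neg]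
        _ ≤ 3 * (1 / ((R : ℝ) - 1)) ^ 2 := one_sub_rampUp_le hR
        _ ≤ lip2 R := by unfold lip2; nlinarith [sq_nonneg (1 / ((R : ℝ) - 1))]
    · rw [pclamp_of_le hR (by omega), pclamp_of_le hR (by omega), pclamp_of_le hR (by omega),
        show (1 : ℝ) - 2 * 1 + 1 = 0 by ring, abs_zero]
      exact lip2_nonneg

/-- the flat start: `pclamp R 1 ≤ 3/(R−1)²` (so `p(1) − 2p(0) + [value 0 on the other side] ≤ 3/(R−1)²`). [folklore] -/
theorem pclamp_one_le : |pclamp R 1| ≤ 3 * (1 / ((R : ℝ) - 1)) ^ 2 := by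
  by_cases h : 1 + 1 ≤ R
  · rw [pclamp_of_lt h]; exact rampUp_one_le hR
  · omega

end Clamp

/-! ## §2 The plateau-and-ramp profile -/

/-- the plateau-and-ramp profile: `1` on `[0, R₁]`, then decreasing along the clamped ramp at scale `R`, `0` for `R₁ + R ≤ i + 1`. [folklore] -/
def qprof (R R₁ i : ℕ) : ℝ := 1 - pclamp R (i - R₁)

section Q

variable {R : ℕ} (hR : 2 ≤ R) (R₁ : ℕ)
include hR

/-- `0 ≤ qprof ≤ 1`. [folklore] -/
theorem qprof_mem (i : ℕ) : 0 ≤ qprof R R₁ i ∧ qprof R R₁ i ≤ 1 := by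
  have h := pclamp_mem hR (i - R₁); unfold qprof; constructor <;> linarith [h.1, h.2]

omit hR in
/-- `qprof = 1` on the plateau `i ≤ R₁` (`R ≥ 1`). [folklore] -/
theorem qprof_eq_one (h1 : 1 ≤ R) {i : ℕ} (hi : i ≤ R₁) : qprof R R₁ i = 1 := by
  rw [qprof, show i - R₁ = 0 by omega, pclamp_zero h1, sub_zero]

/-- `qprof = 0` past the ramp `R₁ + R ≤ i + 1`. [folklore] -/
theorem qprof_eq_zero {i : ℕ} (hi : R₁ + R ≤ i + 1) : qprof R R₁ i = 0 := by
  rw [qprof, pclamp_of_le hR (by omega), sub_self]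

/-- **first differences** of `qprof`: `≤ 3/(2(R−1))` for every `i`. [folklore] -/
theorem qprof_step (i : ℕ) : |qprof R R₁ (i + 1) - qprof R R₁ i| ≤ lip1 R := by
  unfold qprof
  by_cases h : R₁ ≤ i
  · rw [show i + 1 - R₁ = (i - R₁) + 1 by omega,
      show (1 - pclamp R (i - R₁ + 1)) - (1 - pclamp R (i - R₁)) = -(pclamp R (i - R₁ + 1) - pclamp R (i - R₁)) by ring, abs_neg]
    exact pclamp_step hR _
  · rw [show i + 1 - R₁ = 0 by omega, show i - R₁ = 0 by omega, sub_self, abs_zero]; exact lip1_nonneg hR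

/-- **second differences** of `qprof`: `≤ 6/(R−1)²` for every `i` (on the plateau: `0`; at the plateau junction: `pclamp R 1 ≤ 3/(R−1)²`;
on the ramp and beyond: `pclamp_second`). [folklore] -/
theorem qprof_second (i : ℕ) : |qprof R R₁ (i + 2) - 2 * qprof R R₁ (i + 1) + qprof R R₁ i| ≤ lip2 R := by
  unfold qprof
  by_cases h : R₁ ≤ i
  · rw [show i + 2 - R₁ = (i - R₁) + 2 by omega, show i + 1 - R₁ = (i - R₁) + 1 by omega,
      show (1 - pclamp R (i - R₁ + 2)) - 2 * (1 - pclamp R (i - R₁ + 1)) + (1 - pclamp R (i - R₁))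
        = -(pclamp R (i - R₁ + 2) - 2 * pclamp R (i - R₁ + 1) + pclamp R (i - R₁)) by ring, abs_neg]
    exact pclamp_second hR _
  · by_cases h1 : i + 1 = R₁
    · -- the plateau junction: arguments `1, 0, 0`
      rw [show i + 2 - R₁ = 1 by omega, show i + 1 - R₁ = 0 by omega, show i - R₁ = 0 by omega, pclamp_zero (by omega)]
      calc |(1 - pclamp R 1) - 2 * (1 - 0) + (1 - (0 : ℝ))| = |pclamp R 1| := by
            rw [show (1 - pclamp R 1) - 2 * (1 - 0) + (1 - (0 : ℝ)) = -pclamp R 1 by ring, abs_neg]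
        _ ≤ 3 * (1 / ((R : ℝ) - 1)) ^ 2 := pclamp_one_le hR
        _ ≤ lip2 R := by unfold lip2; nlinarith [sq_nonneg (1 / ((R : ℝ) - 1))]
    · rw [show i + 2 - R₁ = 0 by omega, show i + 1 - R₁ = 0 by omega, show i - R₁ = 0 by omega,
        show (1 - pclamp R 0) - 2 * (1 - pclamp R 0) + (1 - pclamp R 0) = (0 : ℝ) by ring, abs_zero]
      exact lip2_nonneg

/-- the second difference in the symmetric form `|2q(i+1) − q(i+2) − q(i)|` used by the cutoff structures. [folklore] -/
theorem qprof_second' (i : ℕ) : |2 * qprof R R₁ (i + 1) - qprof R R₁ (i + 2) - qprof R R₁ i| ≤ lip2 R := by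
  rw [show 2 * qprof R R₁ (i + 1) - qprof R R₁ (i + 2) - qprof R R₁ i = -(qprof R R₁ (i + 2) - 2 * qprof R R₁ (i + 1) + qprof R R₁ i) by ring,
    abs_neg]
  exact qprof_second hR R₁ i

/-- a REVERSED profile `i ↦ q(K − i)` has the same first-difference bound. [folklore] -/
theorem qprof_rev_step (K i : ℕ) : |qprof R R₁ (K - (i + 1)) - qprof R R₁ (K - i)| ≤ lip1 R := by
  by_cases h : i + 1 ≤ K
  · have e : K - i = (K - (i + 1)) + 1 := by omega
    rw [e, abs_sub_comm]; exact qprof_step hR R₁ _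
  · rw [show K - (i + 1) = 0 by omega, show K - i = 0 by omega, sub_self, abs_zero]; exact lip1_nonneg hR

/-- a REVERSED profile has the same second-difference bound, provided the reversal point is not crossed inside the triple
(`i + 2 ≤ K`) or the profile is constant there (`R₁ ≥ 1` makes `q(0) = q(1) = 1`, so the clamp at `K` is harmless when `R₁ ≥ 2`). [folklore] -/
theorem qprof_rev_second {K i : ℕ} (h : i + 2 ≤ K) :
    |qprof R R₁ (K - (i + 2)) - 2 * qprof R R₁ (K - (i + 1)) + qprof R R₁ (K - i)| ≤ lip2 R := by
  have e1 : K - (i + 1) = (K - (i + 2)) + 1 := by omega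
  have e2 : K - i = (K - (i + 2)) + 2 := by omega
  rw [e1, e2, show qprof R R₁ (K - (i + 2)) - 2 * qprof R R₁ (K - (i + 2) + 1) + qprof R R₁ (K - (i + 2) + 2)
      = qprof R R₁ (K - (i + 2) + 2) - 2 * qprof R R₁ (K - (i + 2) + 1) + qprof R R₁ (K - (i + 2)) by ring]
  exact qprof_second hR R₁ _

end Q

/-! ## §3 First and second differences of a finite product of `[0,1]`-valued factors -/

section Prod

variable {ι : Type*}

/-- a product of `[0,1]`-valued factors lies in `[0,1]`. [folklore] -/
theorem prod_mem (s : Finset ι) {f : ι → ℝ} (hf : ∀ i ∈ s, 0 ≤ f i ∧ f i ≤ 1) : 0 ≤ ∏ i ∈ s, f i ∧ ∏ i ∈ s, f i ≤ 1 :=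
  ⟨Finset.prod_nonneg fun i hi => (hf i hi).1, Finset.prod_le_one (fun i hi => (hf i hi).1) fun i hi => (hf i hi).2⟩

/-- **first difference of a product**: `|∏ f − ∏ g| ≤ Σ |f − g|` for `[0,1]`-valued factors. [folklore] -/
theorem abs_prod_sub_prod_le [DecidableEq ι] (s : Finset ι) {f g : ι → ℝ} (hf : ∀ i ∈ s, 0 ≤ f i ∧ f i ≤ 1)
    (hg : ∀ i ∈ s, 0 ≤ g i ∧ g i ≤ 1) : |∏ i ∈ s, f i - ∏ i ∈ s, g i| ≤ ∑ i ∈ s, |f i - g i| := by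
  induction s using Finset.induction_on with
  | empty => simp
  | insert a s ha ih =>
    have hf' : ∀ i ∈ s, 0 ≤ f i ∧ f i ≤ 1 := fun i hi => hf i (Finset.mem_insert_of_mem hi)
    have hg' : ∀ i ∈ s, 0 ≤ g i ∧ g i ≤ 1 := fun i hi => hg i (Finset.mem_insert_of_mem hi)
    have hfa := hf a (Finset.mem_insert_self a s)
    have hPg := prod_mem s hg'
    have hPf := prod_mem s hf'
    rw [Finset.prod_insert ha, Finset.prod_insert ha, Finset.sum_insert ha]
    -- `f_a P_f − g_a P_g = f_a (P_f − P_g) + (f_a − g_a) P_g`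
    have e : f a * ∏ i ∈ s, f i - g a * ∏ i ∈ s, g i
        = f a * (∏ i ∈ s, f i - ∏ i ∈ s, g i) + (f a - g a) * ∏ i ∈ s, g i := by ring
    rw [e]
    refine (abs_add_le _ _).trans ?_
    rw [abs_mul, abs_mul, abs_of_nonneg hfa.1, abs_of_nonneg hPg.1]
    have h1 : f a * |∏ i ∈ s, f i - ∏ i ∈ s, g i| ≤ ∑ i ∈ s, |f i - g i| :=
      (mul_le_of_le_one_left (abs_nonneg _) hfa.2).trans (ih hf' hg')
    have h2 : |f a - g a| * ∏ i ∈ s, g i ≤ |f a - g a| := mul_le_of_le_one_right (abs_nonneg _) hPg.2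
    linarith

/-- **second difference of a product**: `|∏ f + ∏ h − 2∏ g| ≤ Σ|f + h − 2g| + (Σ|f − g|)² + (Σ|h − g|)²` for `[0,1]`-valued factors
(`f, g, h` = the factors at `x + e`, `x`, `x − e`). [folklore] -/
theorem abs_prod_second_le [DecidableEq ι] (s : Finset ι) {f g h : ι → ℝ} (hf : ∀ i ∈ s, 0 ≤ f i ∧ f i ≤ 1)
    (hg : ∀ i ∈ s, 0 ≤ g i ∧ g i ≤ 1) (hh : ∀ i ∈ s, 0 ≤ h i ∧ h i ≤ 1) :
    |∏ i ∈ s, f i + ∏ i ∈ s, h i - 2 * ∏ i ∈ s, g i|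
      ≤ ∑ i ∈ s, |f i + h i - 2 * g i| + (∑ i ∈ s, |f i - g i|) ^ 2 + (∑ i ∈ s, |h i - g i|) ^ 2 := by
  induction s using Finset.induction_on with
  | empty => norm_num
  | insert a s ha ih =>
    have hf' : ∀ i ∈ s, 0 ≤ f i ∧ f i ≤ 1 := fun i hi => hf i (Finset.mem_insert_of_mem hi)
    have hg' : ∀ i ∈ s, 0 ≤ g i ∧ g i ≤ 1 := fun i hi => hg i (Finset.mem_insert_of_mem hi)
    have hh' : ∀ i ∈ s, 0 ≤ h i ∧ h i ≤ 1 := fun i hi => hh i (Finset.mem_insert_of_mem hi)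
    have hfa := hf a (Finset.mem_insert_self a s)
    have hga := hg a (Finset.mem_insert_self a s)
    have hha := hh a (Finset.mem_insert_self a s)
    have hPg := prod_mem s hg'
    set Pf := ∏ i ∈ s, f i
    set Pg := ∏ i ∈ s, g i
    set Ph := ∏ i ∈ s, h i
    set Sf := ∑ i ∈ s, |f i - g i|
    set Sh := ∑ i ∈ s, |h i - g i|
    set S2 := ∑ i ∈ s, |f i + h i - 2 * g i|
    have hSf : 0 ≤ Sf := Finset.sum_nonneg fun _ _ => abs_nonneg _
    have hSh : 0 ≤ Sh := Finset.sum_nonneg fun _ _ => abs_nonneg _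
    have hDf : |Pf - Pg| ≤ Sf := abs_prod_sub_prod_le s hf' hg'
    have hDh : |Ph - Pg| ≤ Sh := abs_prod_sub_prod_le s hh' hg'
    have hih : |Pf + Ph - 2 * Pg| ≤ S2 + Sf ^ 2 + Sh ^ 2 := ih hf' hg' hh'
    rw [Finset.prod_insert ha, Finset.prod_insert ha, Finset.prod_insert ha, Finset.sum_insert ha, Finset.sum_insert ha,
      Finset.sum_insert ha]
    -- the four-term expansion
    have e : f a * Pf + h a * Ph - 2 * (g a * Pg)
        = g a * (Pf + Ph - 2 * Pg) + Pg * (f a + h a - 2 * g a) + (f a - g a) * (Pf - Pg) + (h a - g a) * (Ph - Pg) := by ring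
    rw [e]
    have t1 : |g a * (Pf + Ph - 2 * Pg)| ≤ S2 + Sf ^ 2 + Sh ^ 2 := by
      rw [abs_mul, abs_of_nonneg hga.1]; exact (mul_le_of_le_one_left (abs_nonneg _) hga.2).trans hih
    have t2 : |Pg * (f a + h a - 2 * g a)| ≤ |f a + h a - 2 * g a| := by
      rw [abs_mul, abs_of_nonneg hPg.1]; exact mul_le_of_le_one_left (abs_nonneg _) hPg.2
    have t3 : |(f a - g a) * (Pf - Pg)| ≤ |f a - g a| * Sf := by
      rw [abs_mul]; exact mul_le_mul_of_nonneg_left hDf (abs_nonneg _)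
    have t4 : |(h a - g a) * (Ph - Pg)| ≤ |h a - g a| * Sh := by
      rw [abs_mul]; exact mul_le_mul_of_nonneg_left hDh (abs_nonneg _)
    have hsum := (abs_add_le _ _).trans (add_le_add ((abs_add_le _ _).trans (add_le_add ((abs_add_le _ _).trans (add_le_add t1 t2)) t3)) t4)
    refine hsum.trans ?_
    nlinarith [abs_nonneg (f a - g a), abs_nonneg (h a - g a), hSf, hSh]

/-- the product over a finset where only the factors in a sub-finset `A` may differ: the sums reduce to `A`. [folklore] -/
theorem sum_abs_sub_eq_of_eqOn [DecidableEq ι] {s A : Finset ι} (hA : A ⊆ s) {f g : ι → ℝ} (h : ∀ i ∈ s, i ∉ A → f i = g i) :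
    ∑ i ∈ s, |f i - g i| = ∑ i ∈ A, |f i - g i| := by
  rw [← Finset.sum_sdiff hA, Finset.sum_eq_zero fun i hi => ?_, zero_add]
  rw [Finset.mem_sdiff] at hi
  rw [h i hi.1 hi.2, sub_self, abs_zero]

/-- a sum of at most `m` terms each `≤ ℓ` is `≤ m·ℓ`. [folklore] -/
theorem sum_le_card_mul {A : Finset ι} {u : ι → ℝ} {ℓ : ℝ} (h : ∀ i ∈ A, u i ≤ ℓ) : ∑ i ∈ A, u i ≤ A.card * ℓ := by
  calc ∑ i ∈ A, u i ≤ ∑ _i ∈ A, ℓ := Finset.sum_le_sum h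
    _ = A.card * ℓ := by rw [Finset.sum_const, nsmul_eq_mul]

end Prod

end Summit.QuantumFields.BalabanUV.T4Continuum.ScaleProfile

end
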